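/-
Copyright (c) 2026. All rights reserved.
Released under Apache 2.0 license as described in the file LICENSE.
Authors: abc-iut cell, seat abc-iut-L4-t6 (gen 9; row «P13viii′-NODAL-IV», step CT0-EXOTIC, part 1/2).
-/
import Literature.AnabelianGeometry.AbsoluteAnabelian.AbsTopII.DehnTwistFixedSubgroup
import Literature.AnabelianGeometry.SemiGraphs.ProSigmaCompletionZHatTwist
import HarnessLib

/-!
# Fox calculus for `F̂₂` in finite split extensions by permutation modules (engine of the exotic-twist theorem)

S. Mochizuki, *Topics in Absolute Anabelian Geometry II* [AbsTopII] (`MochizukiAbsTopII2013`; kurims manuscript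
`paper:url-585b8d0ad0d9`), §1, Prop 1.3 (v) p. 12 ("`D_v = C_{Π_H}(I_v) = N_{Π_H}(I_v)`") and (viii) p. 12, at the nodal
Dehn-twist datum `DehnTwist.dpsc i hi` (abc-iut-L4-t6 `DehnTwistLoopDatum`: `Π_𝔾 = F̂₂ = ⟨a,b⟩^`,
`Π_v = ⟨b^Ẑ, a b^Ẑ a⁻¹⟩^`, twist `shear k : a ↦ a·b^k, b ↦ b`).  Classical tool: Fox's free differential calculus read
in split extensions (Lyndon–Schupp, *Combinatorial Group Theory*, Ch. II §3) [cite: LyndonSchupp2001, Ch. II §3].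

PROOF-ONLY file (no definition), abc-iut-L4-t6 (gen 9); part 1 of the proof that the fixed subgroup of a SINGLE
non-trivial twist `shear κ` (`κ ∈ Ẑ ∖ {0}` ARBITRARY — zero divisors included) is `Π_v` (part 2:
`DehnTwistFixedSubgroupExotic.lean`).  Complementary to abc-iut-f-069's `FoxChain.*` (p478344: coefficients in a field,
twist exponent a unit); here the coefficients are `ℤ/q` inside the PERMUTATION module `V = (G/Q → ℤ/q)` of a finite
quotient `G` of `F̂₂` modulo a subgroup `Q ∋ β, αβα⁻¹` (`α, β` the images of `a, b`), so that non-unit exponents can be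
tracked.  Contents:
* §1 `exists_ext_semidirect` (universal property of `F̂₂` into a finite `N ⋊ G`), `right_eq_right_of_gens`,
  **`left_eq_pow_mul_left_of_gens`** (product rule: the `N`-components of continuous homomorphisms `F̂₂ → N ⋊ G` with
  equal `G`-parts multiply like Fox derivatives), **`left_pow_eq_one_of_shear_eq`** (a twist fixing `x` and trivial on
  `G` kills the `m`-th power of the `a`-derivative of `x` against the translated vector);
* §2 `shear_pow_eq_self_of_shear_eq_self`, **`exists_theta`** — the involution `θ : a ↦ a⁻¹, b ↦ aba⁻¹` with
  `shear k ∘ θ = θ ∘ shear k⁻¹`, preserving every `Fix(shear k)`;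
* §3 `mulAutArrow_mulSingle` (`g • δ_{hQ} = δ_{ghQ}`), `mulSingle_coe_eq_of_mem`;
* §4 **`foxA_pow_eq_one`** / **`foxB_pow_eq_one`**: for `β ∈ Q` (resp. `αβα⁻¹ ∈ Q`), `β^m = 1`, `shear κ x = x`, `e` an
  exponent of `S = V ⋊ G`: the `V`-component of `x` under `E_A : a ↦ (δ_{αQ}, α), b ↦ (1, β)` (resp.
  `E_B : a ↦ (δ_Q⁻¹, α), b ↦ (1,β)`) has trivial `(m · (κ mod e))`-th power.
HONEST FRAMING: classical profinite group theory (free profinite groups, finite quotients) under OUR kernel check, at a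
constructed model (constructed ≠ geometric); nothing here bears on [IUTchIII] Cor 3.12; no side taken.
-/

noncomputable section

open scoped Pointwise

namespace Literature.AnabelianGeometry.AbsoluteAnabelian.AbsTopII.DehnTwist

open Literature.AnabelianGeometry.EtaleTheta.SettingModel
open Literature.AnabelianGeometry.EtaleTheta
open Literature.AnabelianGeometry.SemiGraphs.SemiGraphOfAnabelioids.IsProSigmaCompletion (zhat_monoidHom_apply_eq_pow)
open Function _root_.Topology

/-! ### §1 Continuous homomorphisms `F̂₂ → N ⋊ G` into finite split extensions with abelian kernel -/

section SplitExtension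

variable {N G : Type} [CommGroup N] [Group G] {φ : G →* MulAut N}
  [TopologicalSpace (N ⋊[φ] G)] [DiscreteTopology (N ⋊[φ] G)]

/-- Universal property of `F̂₂` into a finite split extension: a continuous homomorphism with prescribed values
on `a`, `b`. [cite: LyndonSchupp2001, Ch. II §3] -/
theorem exists_ext_semidirect [Finite (N ⋊[φ] G)] (s₀ s₁ : N ⋊[φ] G) :
    ∃ E : F₂hatT →ₜ* N ⋊[φ] G, E genA = s₀ ∧ E genB = s₁ := by
  obtain ⟨E, hE⟩ := exists_continuousMonoidHom_extend F₂ (N ⋊[φ] G) (FreeGroup.lift ![s₀, s₁])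
  refine ⟨E, ?_, ?_⟩
  · have h := hE (FreeGroup.of 0)
    rw [FreeGroup.lift_apply_of] at h
    exact h
  · have h := hE (FreeGroup.of 1)
    rw [FreeGroup.lift_apply_of] at h
    exact h

/-- Two continuous homomorphisms `F̂₂ → N ⋊ G` with the same `G`-components on `a`, `b` have the same
`G`-component everywhere. [cite: LyndonSchupp2001, Ch. II §3] -/
theorem right_eq_right_of_gens (E E' : F₂hatT →ₜ* N ⋊[φ] G) (ha : (E genA).right = (E' genA).right)
    (hb : (E genB).right = (E' genB).right) (y : F₂hatT) : (E y).right = (E' y).right := by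
  let r : (N ⋊[φ] G) →ₜ* (N ⋊[φ] G) :=
    ⟨(SemidirectProduct.inr : G →* N ⋊[φ] G).comp SemidirectProduct.rightHom, continuous_of_discreteTopology⟩
  have h := ext_of_eta (f := r.comp E) (f' := r.comp E')
    (by show SemidirectProduct.inr (E genA).right = SemidirectProduct.inr (E' genA).right; rw [ha])
    (by show SemidirectProduct.inr (E genB).right = SemidirectProduct.inr (E' genB).right; rw [hb])
  have hy := DFunLike.congr_fun h y
  exact SemidirectProduct.inr_injective hy

/-- **Fox calculus, product rule.**  If `E, E', E'' : F̂₂ → N ⋊ G` are continuous homomorphisms with the same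
`G`-components on the generators and `(E'' s).left = (E' s).left ^ m · (E s).left` for `s = a, b`, then the same
identity holds at EVERY element of `F̂₂` (the map `y ↦ ((E' y).left^m (E y).left, (E y).right)` is a continuous
homomorphism because `N` is commutative). [cite: LyndonSchupp2001, Ch. II §3] -/
theorem left_eq_pow_mul_left_of_gens (E E' E'' : F₂hatT →ₜ* N ⋊[φ] G) (m : ℕ)
    (ha' : (E' genA).right = (E genA).right) (hb' : (E' genB).right = (E genB).right)
    (ha'' : (E'' genA).right = (E genA).right) (hb'' : (E'' genB).right = (E genB).right)
    (hla : (E'' genA).left = (E' genA).left ^ m * (E genA).left)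
    (hlb : (E'' genB).left = (E' genB).left ^ m * (E genB).left) (y : F₂hatT) :
    (E'' y).left = (E' y).left ^ m * (E y).left := by
  have hr : ∀ z, (E' z).right = (E z).right := right_eq_right_of_gens E' E ha' hb'
  let Φ : F₂hatT →ₜ* N ⋊[φ] G :=
    { toFun := fun z => ⟨(E' z).left ^ m * (E z).left, (E z).right⟩
      map_one' := by
        simp only [map_one, SemidirectProduct.one_left, SemidirectProduct.one_right, one_pow, mul_one]
        rfl
      map_mul' := fun z z' => by
        ext
        · simp only [map_mul, SemidirectProduct.mul_left, map_mul (φ _), map_pow, hr]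
          rw [mul_pow, mul_mul_mul_comm]
        · simp only [map_mul, SemidirectProduct.mul_right]
      continuous_toFun := by
        have hc : Continuous fun z => (E' z, E z) := E'.continuous.prodMk E.continuous
        exact (continuous_of_discreteTopology (f := fun w : (N ⋊[φ] G) × (N ⋊[φ] G) =>
          (⟨w.1.left ^ m * w.2.left, w.2.right⟩ : N ⋊[φ] G))).comp hc }
  have hΦ : Φ = E'' := ext_of_eta
    (by show (⟨(E' genA).left ^ m * (E genA).left, (E genA).right⟩ : N ⋊[φ] G) = E'' genA
        rw [← hla, ← ha''])
    (by show (⟨(E' genB).left ^ m * (E genB).left, (E genB).right⟩ : N ⋊[φ] G) = E'' genB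
        rw [← hlb, ← hb''])
  have h := DFunLike.congr_fun hΦ y
  rw [← h]
  rfl

/-- **Fox calculus and the twist.**  Let `E₀, E_A : F̂₂ → N ⋊ G` be continuous homomorphisms with
`E₀ a = (1, α)`, `E_A a = (u, α)`, `E_A b = (1, (E₀ b).right)`, and let `k ∈ Ẑ` be a twist FIXING `x` whose
`b`-power has `E₀ (b^k) = (w, 1)` with `α • w = u^m`.  Then `(E_A x).left ^ m = 1`: `E₀ ∘ shear k` has generator
values `(u^m, α)`, `E₀ b`, so it is `E_A^{⊙ m} ⊙ E₀` by the product rule, and it agrees with `E₀` at `x`.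
[cite: LyndonSchupp2001, Ch. II §3] -/
theorem left_pow_eq_one_of_shear_eq (E₀ EA : F₂hatT →ₜ* N ⋊[φ] G) {k : ZH} {x : F₂hatT} (hx : shear k x = x)
    {α : G} {u w : N} {m : ℕ} (h0a : E₀ genA = SemidirectProduct.inr α)
    (hAa : EA genA = ⟨u, α⟩) (hAb : EA genB = SemidirectProduct.inr (E₀ genB).right)
    (hk : E₀ (bPow k) = SemidirectProduct.inl w) (hw : φ α w = u ^ m) :
    (EA x).left ^ m = 1 := by
  -- the twisted homomorphism
  let E₁ : F₂hatT →ₜ* N ⋊[φ] G := E₀.comp (shearEnd k)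
  have h1a : E₁ genA = ⟨u ^ m, α⟩ := by
    show E₀ (shear k (eta (FreeGroup.of 0))) = _
    rw [shear_eta_of_zero, map_mul, hk, show eta (FreeGroup.of 0) = genA from rfl, h0a]
    ext
    · simp only [SemidirectProduct.mul_left, SemidirectProduct.left_inr, SemidirectProduct.right_inr,
        SemidirectProduct.left_inl, one_mul, hw]
    · simp only [SemidirectProduct.mul_right, SemidirectProduct.right_inr, SemidirectProduct.right_inl, mul_one]
  have h1b : E₁ genB = E₀ genB := by
    show E₀ (shear k (eta (FreeGroup.of 1))) = _
    rw [shear_apply, shearEnd_eta_of_one]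
  have key := left_eq_pow_mul_left_of_gens E₀ EA E₁ m (by rw [hAa, h0a]; rfl) (by rw [hAb]; rfl)
    (by rw [h1a, h0a]; rfl) (by rw [h1b]) (by rw [h1a, hAa, h0a]; simp) (by rw [h1b, hAb]; simp) x
  have hE₁x : E₁ x = E₀ x := by
    show E₀ (shear k x) = E₀ x
    rw [hx]
  rw [hE₁x] at key
  exact mul_right_cancel (key.symm.trans (one_mul (E₀ x).left).symm)

end SplitExtension

/-! ### §2 Iterated twists and the involution `θ : a ↦ a⁻¹, b ↦ aba⁻¹` -/

/-- `shear` iterates: an element fixed by `shear k` is fixed by `shear (k^n)`. [cite: MochizukiAbsTopII2013, Prop 1.3 (v) p.12] -/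
theorem shear_pow_eq_self_of_shear_eq_self {k : ZH} {x : F₂hatT} (hx : shear k x = x) (n : ℕ) :
    shear (k ^ n) x = x := by
  induction n with
  | zero => rw [pow_zero, shear_one]
  | succ n ih => rw [pow_succ, shear_mul, hx, ih]

/-- **The involution `θ`** of `F̂₂` with `θ a = a⁻¹`, `θ b = a b a⁻¹` exists as a continuous endomorphism, reverses
the twist (`shear k ∘ θ = θ ∘ shear k⁻¹`), hence preserves the fixed set of every `shear k`.
[cite: LyndonSchupp2001, Ch. I §4] -/
theorem exists_theta : ∃ θ : F₂hatT →ₜ* F₂hatT, θ genA = genA⁻¹ ∧ θ genB = genA * genB * genA⁻¹ ∧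
    ∀ (k : ZH) (y : F₂hatT), shear k y = y → shear k (θ y) = θ y := by
  let θ : F₂hatT →ₜ* F₂hatT :=
    (ProfiniteGrp.ProfiniteCompletion.lift (P := F₂hat)
      (GrpCat.ofHom (FreeGroup.lift ![genA⁻¹, genA * genB * genA⁻¹]))).hom
  have hθ : ∀ g : F₂, θ (eta g) = FreeGroup.lift ![genA⁻¹, genA * genB * genA⁻¹] g :=
    fun g => Literature.AnabelianGeometry.SemiGraphs.lift_hom_toCompletion F₂hat _ g
  have hθa : θ genA = genA⁻¹ := by
    show θ (eta (FreeGroup.of 0)) = _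
    rw [hθ, FreeGroup.lift_apply_of]; rfl
  have hθb : θ genB = genA * genB * genA⁻¹ := by
    show θ (eta (FreeGroup.of 1)) = _
    rw [hθ, FreeGroup.lift_apply_of]; rfl
  -- `θ (b^t) = a b^t a⁻¹`
  have hθbPow : ∀ t : ZH, θ (bPow t) = genA * bPow t * genA⁻¹ := by
    have h := ZHatCompletion.monoidHom_ext_of_continuous
      (f₁ := θ.toMonoidHom.comp bPow.toMonoidHom)
      (f₂ := (MulAut.conj genA).toMonoidHom.comp bPow.toMonoidHom)
      (θ.continuous.comp bPow.continuous)
      (((continuous_const.mul continuous_id).mul continuous_const).comp bPow.continuous) (by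
        show θ (bPow (iotaZ (Multiplicative.ofAdd 1))) = genA * bPow (iotaZ (Multiplicative.ofAdd 1)) * genA⁻¹
        rw [bPow_iotaZ_one]
        exact hθb)
    intro t
    exact DFunLike.congr_fun h t
  -- `shear k ∘ θ = θ ∘ shear k⁻¹`
  have hcomm : ∀ k : ZH, (shearEnd k).comp θ = θ.comp (shearEnd k⁻¹) := by
    intro k
    refine ext_of_eta ?_ ?_
    · show shear k (θ (eta (FreeGroup.of 0))) = θ (shear k⁻¹ (eta (FreeGroup.of 0)))
      rw [shear_eta_of_zero k⁻¹, map_mul, hθbPow, map_inv bPow, show eta (FreeGroup.of 0) = genA from rfl, hθa,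
        map_inv, show shear k genA = genA * bPow k from shear_eta_of_zero k]
      group
    · show shear k (θ (eta (FreeGroup.of 1))) = θ (shear k⁻¹ (eta (FreeGroup.of 1)))
      rw [shear_apply k⁻¹, shearEnd_eta_of_one, show eta (FreeGroup.of 1) = genB from rfl, hθb, map_mul, map_mul,
        map_inv, show shear k genA = genA * bPow k from shear_eta_of_zero k,
        show shear k genB = genB from shearEnd_eta_of_one k]
      -- `(a b^k) b (a b^k)⁻¹ = a b a⁻¹`
      have hcb : bPow k * genB = genB * bPow k := by
        rw [show genB = bPow (iotaZ (Multiplicative.ofAdd 1)) from bPow_iotaZ_one.symm, ← map_mul, ← map_mul,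
          ZHatCompletion.mul_comm]
      calc genA * bPow k * genB * (genA * bPow k)⁻¹
          = genA * (bPow k * genB) * (bPow k)⁻¹ * genA⁻¹ := by group
        _ = genA * genB * genA⁻¹ := by rw [hcb]; group
  refine ⟨θ, hθa, hθb, fun k y hy => ?_⟩
  have h := DFunLike.congr_fun (hcomm k) y
  change shear k (θ y) = θ (shear k⁻¹ y) at h
  rw [h]
  congr 1
  conv_lhs => rw [← hy]
  rw [← shear_mul, inv_mul_cancel, shear_one]

/-! ### §3 The permutation module `(G/Q → ℤ/q) ⋊ G` -/

section PermutationModule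

variable {G : Type} [Group G] (Q : Subgroup G) (q : ℕ)

/-- `G` translates indicator functions of cosets: `g • δ_{hQ} = δ_{ghQ}`. [cite: LyndonSchupp2001, Ch. II §3] -/
theorem mulAutArrow_mulSingle [DecidableEq (G ⧸ Q)] (g h : G) (v : Multiplicative (ZMod q)) :
    (mulAutArrow g : MulAut (G ⧸ Q → Multiplicative (ZMod q))) (Pi.mulSingle ((h : G) : G ⧸ Q) v) =
      Pi.mulSingle ((g * h : G) : G ⧸ Q) v := by
  funext c
  have h1 : (mulAutArrow g : MulAut (G ⧸ Q → Multiplicative (ZMod q))) (Pi.mulSingle ((h : G) : G ⧸ Q) v) c =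
      (Pi.mulSingle ((h : G) : G ⧸ Q) v : G ⧸ Q → Multiplicative (ZMod q)) (g⁻¹ • c) := rfl
  rw [h1, Pi.mulSingle_apply, Pi.mulSingle_apply]
  have hc : g⁻¹ • c = ((h : G) : G ⧸ Q) ↔ c = ((g * h : G) : G ⧸ Q) := by
    rw [inv_smul_eq_iff, MulAction.Quotient.smul_coe, smul_eq_mul]
  simp only [hc]

/-- Cosets of elements of `Q`: `δ_{gQ} = δ_Q` for `g ∈ Q`. [cite: LyndonSchupp2001, Ch. II §3] -/
theorem mulSingle_coe_eq_of_mem [DecidableEq (G ⧸ Q)] {g : G} (hg : g ∈ Q) (v : Multiplicative (ZMod q)) :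
    (Pi.mulSingle ((g : G) : G ⧸ Q) v : G ⧸ Q → Multiplicative (ZMod q)) = Pi.mulSingle ((1 : G) : G ⧸ Q) v := by
  have : ((g : G) : G ⧸ Q) = ((1 : G) : G ⧸ Q) := by
    rw [QuotientGroup.eq, mul_one]
    exact Q.inv_mem hg
  rw [this]

end PermutationModule

/-! ### §4 The Fox argument in one finite split extension -/

section FiniteQuotient

variable {G : Type} [Group G] (Q : Subgroup G) (q : ℕ) [DecidableEq (G ⧸ Q)]
  [TopologicalSpace ((G ⧸ Q → Multiplicative (ZMod q)) ⋊[mulAutArrow] G)]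
  [DiscreteTopology ((G ⧸ Q → Multiplicative (ZMod q)) ⋊[mulAutArrow] G)]
  [Finite ((G ⧸ Q → Multiplicative (ZMod q)) ⋊[mulAutArrow] G)]

/-- **Step (A).**  `α, β ∈ G` with `β ∈ Q` and `β^m = 1`; `κ ∈ Ẑ` with `shear κ x = x`; `e` an exponent of
`S = (G/Q → ℤ/q) ⋊ G`.  If `E_A : F̂₂ → S` extends `a ↦ (δ_{αQ}, α)`, `b ↦ (1, β)`, then
`(E_A x).left ^ (m · (κ mod e)) = 1`. [cite: LyndonSchupp2001, Ch. II §3] -/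
theorem foxA_pow_eq_one (α β : G) (hβ : β ∈ Q) {m : ℕ} (hβm : β ^ m = 1) {κ : ZH} {x : F₂hatT}
    (hx : shear κ x = x) (e : ℕ+) (he : ∀ s : (G ⧸ Q → Multiplicative (ZMod q)) ⋊[mulAutArrow] G, s ^ (e : ℕ) = 1)
    (EA : F₂hatT →ₜ* (G ⧸ Q → Multiplicative (ZMod q)) ⋊[mulAutArrow] G)
    (hAa : EA genA = ⟨Pi.mulSingle ((α : G) : G ⧸ Q) (Multiplicative.ofAdd 1), α⟩)
    (hAb : EA genB = SemidirectProduct.inr β) :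
    (EA x).left ^ (m * (Multiplicative.toAdd (ZHatLevel.level e κ)).val) = 1 := by
  set n : ℕ := (Multiplicative.toAdd (ZHatLevel.level e κ)).val with hn
  set d1 : G ⧸ Q → Multiplicative (ZMod q) := Pi.mulSingle ((1 : G) : G ⧸ Q) (Multiplicative.ofAdd 1) with hd1
  -- `E₀ : a ↦ (1, α), b ↦ (δ_Q, β)`
  obtain ⟨E₀, h0a, h0b⟩ := exists_ext_semidirect
    (SemidirectProduct.inr α : (G ⧸ Q → Multiplicative (ZMod q)) ⋊[mulAutArrow] G) ⟨d1, β⟩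
  -- `E₀ b = inl δ_Q · inr β` with COMMUTING factors (`β ∈ Q` fixes `δ_Q`)
  have hβd : (mulAutArrow β : MulAut (G ⧸ Q → Multiplicative (ZMod q))) d1 = d1 := by
    rw [hd1, mulAutArrow_mulSingle, mul_one, mulSingle_coe_eq_of_mem Q q hβ]
  have hcomm : Commute (SemidirectProduct.inl d1 : (G ⧸ Q → Multiplicative (ZMod q)) ⋊[mulAutArrow] G)
      (SemidirectProduct.inr β) := by
    have h := SemidirectProduct.inl_aut (φ := (mulAutArrow : G →* MulAut (G ⧸ Q → Multiplicative (ZMod q)))) β d1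
    rw [hβd] at h
    show SemidirectProduct.inl d1 * SemidirectProduct.inr β = SemidirectProduct.inr β * SemidirectProduct.inl d1
    calc SemidirectProduct.inl d1 * SemidirectProduct.inr β
        = SemidirectProduct.inr β * SemidirectProduct.inl d1 * SemidirectProduct.inr β⁻¹ *
            SemidirectProduct.inr β := by rw [← h]
      _ = SemidirectProduct.inr β * SemidirectProduct.inl d1 := by
          rw [mul_assoc, ← map_mul, inv_mul_cancel, map_one, mul_one]
  have h0b' : E₀ genB = SemidirectProduct.inl d1 * SemidirectProduct.inr β := by
    rw [h0b, SemidirectProduct.mk_eq_inl_mul_inr]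
  -- powers of `b` under `E₀`: `E₀ (b^t) = E₀(b)^{(t mod e)}`
  have hpow : ∀ t : ZH, E₀ (bPow t) = (E₀ genB) ^ (Multiplicative.toAdd (ZHatLevel.level e t)).val := by
    intro t
    have h := zhat_monoidHom_apply_eq_pow (E₀.toMonoidHom.comp bPow.toMonoidHom) e he t
    change E₀ (bPow t) = E₀ (bPow (ZHatLevel.eta 1)) ^ _ at h
    rw [← iotaZ_one_eq, bPow_iotaZ_one] at h
    exact h
  -- the twist `κ^m` fixes `x` and `E₀ (b^{κ^m}) = inl (δ_Q^{m n})`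
  have hxm : shear (κ ^ m) x = x := shear_pow_eq_self_of_shear_eq_self hx m
  have hk : E₀ (bPow (κ ^ m)) = SemidirectProduct.inl (d1 ^ (m * n)) := by
    rw [map_pow, map_pow, hpow κ, ← hn, ← pow_mul, mul_comm n m, h0b', hcomm.mul_pow, ← map_pow, ← map_pow,
      pow_mul β m n, hβm, one_pow, map_one, mul_one]
  -- apply the abstract step
  refine left_pow_eq_one_of_shear_eq E₀ EA hxm h0a hAa (by rw [hAb, h0b]) hk ?_
  rw [map_pow, hd1, mulAutArrow_mulSingle, mul_one]

/-- **Step (B)** — the same for `E_B : a ↦ (δ_Q⁻¹, α)`, `b ↦ (1, β)`, via the involution `θ`: step (A) for `θ x` at the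
pair `(α⁻¹, αβα⁻¹)` (here `αβα⁻¹ ∈ Q` is used), and `E'_A ∘ θ = E_B`. [cite: LyndonSchupp2001, Ch. II §3] -/
theorem foxB_pow_eq_one (α β : G) (hαβ : α * β * α⁻¹ ∈ Q) {m : ℕ} (hβm : β ^ m = 1) {κ : ZH}
    {x : F₂hatT} (hx : shear κ x = x) (e : ℕ+)
    (he : ∀ s : (G ⧸ Q → Multiplicative (ZMod q)) ⋊[mulAutArrow] G, s ^ (e : ℕ) = 1)
    (EB : F₂hatT →ₜ* (G ⧸ Q → Multiplicative (ZMod q)) ⋊[mulAutArrow] G)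
    (hBa : EB genA = ⟨(Pi.mulSingle ((1 : G) : G ⧸ Q) (Multiplicative.ofAdd 1))⁻¹, α⟩)
    (hBb : EB genB = SemidirectProduct.inr β) :
    (EB x).left ^ (m * (Multiplicative.toAdd (ZHatLevel.level e κ)).val) = 1 := by
  obtain ⟨θ, hθa, hθb, hθfix⟩ := exists_theta
  have hx₁ : shear κ (θ x) = θ x := hθfix κ x hx
  have hβ' : α * β * α⁻¹ ∈ Q := hαβ
  have hβ'm : (α * β * α⁻¹) ^ m = 1 := by rw [conj_pow, hβm, mul_one, mul_inv_cancel]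
  -- step (A) at the pair `(α⁻¹, αβα⁻¹)` for `θ x`
  obtain ⟨EA', hA'a, hA'b⟩ := exists_ext_semidirect
    (⟨Pi.mulSingle ((α⁻¹ : G) : G ⧸ Q) (Multiplicative.ofAdd 1), α⁻¹⟩ :
      (G ⧸ Q → Multiplicative (ZMod q)) ⋊[mulAutArrow] G)
    (SemidirectProduct.inr (α * β * α⁻¹))
  have hA := foxA_pow_eq_one Q q α⁻¹ (α * β * α⁻¹) hβ' hβ'm hx₁ e he EA' hA'a hA'b
  -- `E'_A ∘ θ = E_B`
  have hcoset : ((β * α⁻¹ : G) : G ⧸ Q) = ((α⁻¹ : G) : G ⧸ Q) := by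
    rw [QuotientGroup.eq]
    have : (β * α⁻¹)⁻¹ * α⁻¹ = (α * β * α⁻¹)⁻¹ := by group
    rw [this]
    exact Q.inv_mem hαβ
  have hsw : (⟨Pi.mulSingle ((α⁻¹ : G) : G ⧸ Q) (Multiplicative.ofAdd 1), α⁻¹⟩ :
        (G ⧸ Q → Multiplicative (ZMod q)) ⋊[mulAutArrow] G) * SemidirectProduct.inr (α * β * α⁻¹) =
      SemidirectProduct.inr β * ⟨Pi.mulSingle ((α⁻¹ : G) : G ⧸ Q) (Multiplicative.ofAdd 1), α⁻¹⟩ := by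
    ext
    · simp only [SemidirectProduct.mul_left, SemidirectProduct.left_inr, SemidirectProduct.right_inr, map_one,
        mul_one, one_mul, mulAutArrow_mulSingle, hcoset]
    · simp only [SemidirectProduct.mul_right, SemidirectProduct.right_inr]
      group
  have hcomp : EA'.comp θ = EB := by
    refine ext_of_eta ?_ ?_
    · show EA' (θ genA) = EB genA
      rw [hθa, map_inv, hA'a, hBa]
      ext
      · simp only [SemidirectProduct.inv_left, inv_inv, map_inv, mulAutArrow_mulSingle, mul_inv_cancel]
      · simp only [SemidirectProduct.inv_right, inv_inv]
    · show EA' (θ genB) = EB genB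
      rw [hθb, map_mul, map_mul, map_inv, hA'a, hA'b, hBb, hsw, mul_inv_cancel_right]
  have hEB : EB x = EA' (θ x) := by rw [← hcomp]; rfl
  rw [hEB]
  exact hA

end FiniteQuotient

end Literature.AnabelianGeometry.AbsoluteAnabelian.AbsTopII.DehnTwist

end
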